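import Literature.Analysis.FluidPDE.CLAmplitudes
import Literature.Analysis.FluidPDE.MikadoRescaled
import Literature.Analysis.FluidPDE.IntermittentTimeProfiles
import Literature.Analysis.FluidPDE.NavierStokesConcentrationTools
import Literature.Analysis.FluidPDE.NavierStokesCorrectorAntidivergence
import HarnessLib

/-!
# Cheskidov–Luo convex integration: the velocity perturbation `w = w^{(p)} + w^{(c)} + w^{(t)}`

Analysis/FluidPDE support file (all results proved; definitions are explicit constructions) for
the proof of Prop. 4.1 of A. Cheskidov, X. Luo, *Sharp nonuniqueness for the Navier–Stokes
equations*, Invent. Math. 229 (2022) = arXiv:2009.06596, §4.4 (numbering of the held arXiv copy),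
in the variant fixed in the plan of this series (one time profile `g_x` per direction with
pairwise disjoint supports, so that no two pipes are ever active at the same time; a floor in the
stress cut-off; un-normalised directions `k_x ∈ ℤ^d`).

All the data of the construction are bundled in `CL22.Datum` (time horizon `T`, floor `γ₀`, old
stress `R`, time cut-off `θ`, bumps `g_x`, parameters `ν, κ, μ, σ`), with the standing hypotheses
in `CL22.Datum.Valid`. For `D : Datum d`:

* time factors `D.G x = g_{x,κ}(ν·)` (`Intermittent.oscProfile`), its derivative `D.dG x`, and
  `D.H x = ν⁻¹ h_{x,κ}(ν·)` (`Intermittent.oscPrim`, `H' = G² - 1`; CL22 (4.8)–(4.11));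
* amplitudes `D.ahat x = â_x = ρ^{1/2}Γ_x(Id - R/ρ)` (`CL22.amp`), `D.atil x = θ â_x` (CL22 (4.15):
  `a_k = θ g_κ(νt) ρ^{1/2} Γ_k(Id - R̄/ρ) = G_x · ã_x`), its gradient `D.gradA x`;
* the principal part `D.wp = ∑_x G_x ã_x ψ_x(σ·) k_x` (CL22 (4.16)), the divergence corrector
  `D.wc = ∑_x G_x Ω̃_x[∇ã_x]`, `Ω̃_x v = (∇P_x·v) k_x - (k_x·v) ∇P_x`, `P_x = σ⁻²φ_x(σ·)`
  (CL22 (4.17): `w^{(c)} = σ⁻¹ ∑ ∇a_k : Ω_k(σ·)`), with `wp + wc = ∑_x G_x div(ã_x Ω̃_x)`,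
  `Ω̃_x` skew, hence `div (wp + wc) = 0` and `∫ (wp + wc) = 0` (CL22 (4.18));
* the temporal corrector `D.wt = -∑_x H_x θ² 𝒫 div(â_x² k_x ⊗ k_x)` (CL22 (4.19):
  `w^{(t)} = ν⁻¹ h_κ(νt) 𝒫_H div R̄`; in the one-profile-per-direction variant the tensor
  `θ²ρ Id - R̄` of Lemma 4.4 is replaced by its `x`-th summand `B_x = ã_x² k_x ⊗ k_x`), where
  `𝒫 v = v - ∇Δ⁻¹ div v` (`D.Z x = 𝒫 div B̂_x`, `D.qhat x = Δ⁻¹ div div B̂_x`), divergence free and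
  of zero mean;
* `D.w = wp + wc + wt`: jointly smooth on `[0, T] × 𝕋^d`, divergence free, of zero mean, and
  vanishing at every time where `θ = 0` (CL22 Lemma 4.6: "`w = 0` whenever `dist(t, I^c) ≤ τ`");
* the one-sided time derivatives of `wp`, `wc`, `wt` on `[0, T]` in closed form
  (`timeDerivWithin_wp`, `…_wc`, `…_wt`), the input of the stress algebra (CL22 Lemma 4.5).

## References

* A. Cheskidov, X. Luo, arXiv:2009.06596, §4.2 (4.8)–(4.11), §4.4 (4.15)–(4.19), Lemmas 4.4, 4.6.
  [`CheskidovLuo2022`]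
-/

noncomputable section

open Set Filter Topology Function MeasureTheory Finset
open scoped ContDiff ENNReal

namespace Literature.Analysis.FluidPDE

namespace CL22

open FunctionSpaces NashGeometric Mikado Intermittent

variable {d : Type*} [Fintype d] [DecidableEq d]

/-! ## The data of the construction -/

variable (d) in
/-- **The data of the convex-integration step** (CL22 §4.4): time horizon `T`, floor `γ₀` of the
stress cut-off, the old Reynolds stress `R`, the time cut-off `θ`, one bump `g_x` per direction of
the geometric lemma, and the parameters `ν` (temporal oscillation), `κ` (temporal
concentration), `μ` (spatial concentration), `σ ∈ ℕ` (spatial oscillation). [cite: CheskidovLuo2022, §4.4] -/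
structure Datum where
  /-- time horizon -/
  T : ℝ
  /-- floor of the stress cut-off -/
  γ₀ : ℝ
  /-- the old Reynolds stress (by columns) -/
  R : ℝ → UnitAddTorus d → d → EuclideanSpace ℝ d
  /-- the time cut-off `θ` -/
  θ : ℝ → ℝ
  /-- one bump per direction -/
  g : Index d → ℝ → ℝ
  /-- temporal oscillation -/
  ν : ℝ
  /-- temporal concentration -/
  κ : ℝ
  /-- spatial concentration -/
  μ : ℝ
  /-- spatial oscillation -/
  σ : ℕ

namespace Datum

variable (D : Datum d)

/-- **Standing hypotheses** on the data: `d ≥ 2`, `T > 0`, `γ₀ > 0`, `R` jointly smooth and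
symmetric on `[0, T]`, `θ ∈ C^∞(ℝ; [0,1])`, the `g_x` are bumps in `(0,1)` with `∫g_x² = 1` and
pairwise disjoint supports (`Intermittent.exists_isBump_disjoint`), `ν, κ, μ ≥ 1`, `σ ≥ 1`. [cite: CheskidovLuo2022, §4.4] -/
structure Valid : Prop where
  hd : 2 ≤ Fintype.card d
  hT : 0 < D.T
  hγ : 0 < D.γ₀
  hR : Torus.IsSmoothSpaceTimeOn (Icc 0 D.T) D.R
  hRsym : ∀ t ∈ Icc 0 D.T, ∀ y, ∀ i j : d, D.R t y i j = D.R t y j i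
  hθ : ContDiff ℝ ∞ D.θ
  hθ01 : ∀ t, D.θ t ∈ Icc (0 : ℝ) 1
  hg : ∀ x, IsBump (D.g x)
  hg1 : ∀ x, ∫ s in (0 : ℝ)..1, D.g x s ^ 2 = 1
  hgg : ∀ x x', x ≠ x' → ∀ s, D.g x s * D.g x' s = 0
  hν : 1 ≤ D.ν
  hκ : 1 ≤ D.κ
  hμ : 1 ≤ D.μ
  hσ : 0 < D.σ

/-! ## The objects -/

/-- The time factor `G_x(t) = g_{x,κ}(νt)` (CL22 (4.8), (4.15)). [cite: CheskidovLuo2022, §4.2 (4.8)] -/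
def G (x : Index d) (t : ℝ) : ℝ := oscProfile D.ν D.κ (D.g x) t

/-- The derivative `G_x' = νκ (g_x')_κ(ν·)` of the time factor. [folklore] -/
def dG (x : Index d) (t : ℝ) : ℝ := D.ν * D.κ * oscProfile D.ν D.κ (deriv (D.g x)) t

/-- The primitive factor `H_x(t) = ν⁻¹ h_{x,κ}(νt)`, `H_x' = G_x² - 1` (CL22 (4.10)–(4.11)). [cite: CheskidovLuo2022, §4.2 (4.11)] -/
def H (x : Index d) (t : ℝ) : ℝ := oscPrim D.ν D.κ (D.g x) t

/-- The amplitude core `â_x = ρ^{1/2} Γ_x(Id - R/ρ)`. [cite: CheskidovLuo2022, §4.4 (4.15)] -/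
def ahat (x : Index d) (t : ℝ) (y : UnitAddTorus d) : ℝ := amp D.γ₀ D.R x t y

/-- The cut-off amplitude `ã_x = θ â_x` (so that CL22's `a_k = G_x ã_x`). [cite: CheskidovLuo2022, §4.4 (4.15)] -/
def atil (x : Index d) (t : ℝ) (y : UnitAddTorus d) : ℝ := D.θ t * D.ahat x t y

/-- The gradient `∇ã_x`. [folklore] -/
def gradA (x : Index d) (t : ℝ) (y : UnitAddTorus d) : EuclideanSpace ℝ d := Torus.gradient (D.atil x t) y

/-- The rescaled profile `ψ_x(σ·)`. [cite: CheskidovLuo2022, §4.4 (4.16)] -/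
def Ψ (x : Index d) : UnitAddTorus d → ℝ := psiR x D.μ D.σ

/-- The rescaled potential `P_x = σ⁻² φ_x(σ·)`, `ΔP_x = ψ_x(σ·)`. [cite: CheskidovLuo2022, §4.4 (4.17)] -/
def P (x : Index d) : UnitAddTorus d → ℝ := phiR x D.μ D.σ

/-- The skew operator `Ω̃_x(y) v = (∇P_x(y)·v) k_x - (k_x·v) ∇P_x(y)` (`= σ⁻¹ Ω_k(σy) v` for
CL22's `Ω_k = k ⊗ ∇φ - ∇φ ⊗ k`). [cite: CheskidovLuo2022, §4.4 (4.17)] -/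
def omegaApply (x : Index d) (y : UnitAddTorus d) (v : EuclideanSpace ℝ d) : EuclideanSpace ℝ d :=
  (∑ j, Torus.partialDeriv j (D.P x) y * v j) • dirVec x - (∑ j, ((dir x j : ℤ) : ℝ) * v j) • Torus.gradient (D.P x) y

/-- **The principal part** `w^{(p)} = ∑_x G_x ã_x ψ_x(σ·) k_x` (CL22 (4.16)). [cite: CheskidovLuo2022, §4.4 (4.16)] -/
def wp (t : ℝ) (y : UnitAddTorus d) : EuclideanSpace ℝ d :=
  ∑ x, (D.G x t * D.atil x t y * D.Ψ x y) • dirVec x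

/-- **The divergence corrector** `w^{(c)} = ∑_x G_x Ω̃_x[∇ã_x]` (CL22 (4.17)). [cite: CheskidovLuo2022, §4.4 (4.17)] -/
def wc (t : ℝ) (y : UnitAddTorus d) : EuclideanSpace ℝ d :=
  ∑ x, D.G x t • D.omegaApply x y (D.gradA x t y)

/-- The scalar `â_x²` of the tensor `B̂_x = â_x² k_x ⊗ k_x`. [folklore] -/
def Bsc (x : Index d) (t : ℝ) (y : UnitAddTorus d) : ℝ := D.ahat x t y ^ 2

/-- The tensor `B̂_x = â_x² k_x ⊗ k_x`, by columns (column `j` is `â_x² (k_x)_j k_x`). [folklore] -/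
def Bten (x : Index d) (t : ℝ) : UnitAddTorus d → d → EuclideanSpace ℝ d :=
  fun y j => (D.Bsc x t y * ((dir x j : ℤ) : ℝ)) • dirVec x

/-- `q̂_x = Δ⁻¹ div div B̂_x`. [folklore] -/
def qhat (x : Index d) (t : ℝ) : UnitAddTorus d → ℝ :=
  Torus.invLaplacian (Torus.divergence (Torus.tensorDivergence (D.Bten x t)))

/-- `Z_x = 𝒫 div B̂_x = div B̂_x - ∇Δ⁻¹ div div B̂_x` (Helmholtz projection of `div B̂_x`). [cite: CheskidovLuo2022, §4.4 (4.19)] -/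
def Z (x : Index d) (t : ℝ) (y : UnitAddTorus d) : EuclideanSpace ℝ d :=
  Torus.tensorDivergence (D.Bten x t) y - Torus.gradient (D.qhat x t) y

/-- **The temporal corrector** `w^{(t)} = -∑_x H_x θ² 𝒫 div B̂_x` (CL22 (4.19), one profile per
direction). [cite: CheskidovLuo2022, §4.4 (4.19)] -/
def wt (t : ℝ) (y : UnitAddTorus d) : EuclideanSpace ℝ d :=
  -∑ x, (D.H x t * D.θ t ^ 2) • D.Z x t y

/-- **The velocity perturbation** `w = w^{(p)} + w^{(c)} + w^{(t)}` (CL22 §4.4). [cite: CheskidovLuo2022, §4.4] -/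
def w (t : ℝ) (y : UnitAddTorus d) : EuclideanSpace ℝ d := D.wp t y + D.wc t y + D.wt t y

/-! ## Smoothness -/

section Smooth

variable {D}

omit [DecidableEq d] in
/-- The tensor divergence of a jointly smooth tensor field is jointly smooth. [folklore] -/
theorem isSmoothSpaceTimeOn_tensorDivergence {S : Set ℝ} [DecidableEq d] {A : ℝ → UnitAddTorus d → d → EuclideanSpace ℝ d}
    (hA : Torus.IsSmoothSpaceTimeOn S A) (hS : UniqueDiffOn ℝ S) :
    Torus.IsSmoothSpaceTimeOn S (fun t => Torus.tensorDivergence (A t)) :=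
  Torus.IsSmoothSpaceTimeOn.sum fun j _ => (hA.column j).partialDeriv hS j

variable (h : D.Valid)
include h

omit [DecidableEq d] in
/-- `[0, T]` is a set of unique differentiability (`T > 0`). [folklore] -/
theorem uniqueDiffOn : UniqueDiffOn ℝ (Icc 0 D.T) := uniqueDiffOn_Icc h.hT

omit [DecidableEq d] in
/-- `G_x` is smooth. [folklore] -/
theorem contDiff_G (x : Index d) : ContDiff ℝ ∞ (D.G x) := (h.hg x).contDiff_oscProfile h.hκ D.ν

omit [DecidableEq d] in
/-- `G_x'` is smooth. [folklore] -/
theorem contDiff_dG (x : Index d) : ContDiff ℝ ∞ (D.dG x) :=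
  contDiff_const.mul ((h.hg x).deriv.contDiff_oscProfile h.hκ D.ν)

omit [DecidableEq d] in
/-- `H_x` is smooth. [folklore] -/
theorem contDiff_H (x : Index d) : ContDiff ℝ ∞ (D.H x) := (h.hg x).contDiff_oscPrim h.hκ D.ν

omit [DecidableEq d] in
/-- `G_x' ` is the derivative of `G_x`. [folklore] -/
theorem hasDerivAt_G (x : Index d) (t : ℝ) : HasDerivAt (D.G x) (D.dG x t) t :=
  (h.hg x).hasDerivAt_oscProfile h.hκ D.ν t

omit [DecidableEq d] in
/-- `H_x' = G_x² - 1` (CL22 (4.11)). [cite: CheskidovLuo2022, §4.2 (4.11)] -/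
theorem hasDerivAt_H (x : Index d) (t : ℝ) : HasDerivAt (D.H x) (D.G x t ^ 2 - 1) t :=
  (h.hg x).hasDerivAt_oscPrim h.hκ (by linarith [h.hν]) t

omit [DecidableEq d] in
/-- Different directions are never active at the same time: `G_x G_{x'} = 0` for `x ≠ x'`. [folklore] -/
theorem G_mul_G {x x' : Index d} (hxx' : x ≠ x') (t : ℝ) : D.G x t * D.G x' t = 0 :=
  oscProfile_mul_oscProfile (h.hgg x x' hxx') _ _ _

/-- `â_x` is jointly smooth on `[0, T]`. [folklore] -/
theorem smooth_ahat (x : Index d) : Torus.IsSmoothSpaceTimeOn (Icc 0 D.T) (D.ahat x) :=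
  isSmoothSpaceTimeOn_amp h.hd h.hγ h.hR x

/-- `ã_x` is jointly smooth on `[0, T]`. [folklore] -/
theorem smooth_atil (x : Index d) : Torus.IsSmoothSpaceTimeOn (Icc 0 D.T) (D.atil x) :=
  (smooth_ahat h x).time_smul h.hθ.contDiffOn

/-- `∇ã_x` is jointly smooth on `[0, T]`. [folklore] -/
theorem smooth_gradA (x : Index d) : Torus.IsSmoothSpaceTimeOn (Icc 0 D.T) (D.gradA x) :=
  (smooth_atil h x).gradient (uniqueDiffOn h)

/-- `ψ_x(σ·)` is smooth. [folklore] -/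
theorem isSmooth_Ψ (x : Index d) : Torus.IsSmooth (D.Ψ x) := isSmooth_psiR x h.hμ D.σ

/-- `P_x` is smooth. [folklore] -/
theorem isSmooth_P (x : Index d) : Torus.IsSmooth (D.P x) := isSmooth_phiR x h.hμ D.σ

/-- `Ω̃_x[v]` is jointly smooth for jointly smooth `v`. [folklore] -/
theorem smooth_omegaApply (x : Index d) {S : Set ℝ} {v : ℝ → UnitAddTorus d → EuclideanSpace ℝ d}
    (hv : Torus.IsSmoothSpaceTimeOn S v) : Torus.IsSmoothSpaceTimeOn S (fun t y => D.omegaApply x y (v t y)) := by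
  have hP := isSmooth_P h x
  have h1 : Torus.IsSmoothSpaceTimeOn S (fun t y => ∑ j, Torus.partialDeriv j (D.P x) y * v t y j) :=
    Torus.IsSmoothSpaceTimeOn.sum fun j _ => (Torus.isSmoothSpaceTimeOn_const (hP.partialDeriv j) S).mul (hv.apply j)
  have h2 : Torus.IsSmoothSpaceTimeOn S (fun t y => ∑ j, ((dir x j : ℤ) : ℝ) * v t y j) :=
    Torus.IsSmoothSpaceTimeOn.sum fun j _ => (Torus.isSmoothSpaceTimeOn_const (Torus.isSmooth_const _) S).mul (hv.apply j)
  exact (h1.smul (Torus.isSmoothSpaceTimeOn_const (Torus.isSmooth_const _) S)).sub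
    (h2.smul (Torus.isSmoothSpaceTimeOn_const hP.gradient S))

/-- `w^{(p)}` is jointly smooth on `[0, T]`. [folklore] -/
theorem smooth_wp : Torus.IsSmoothSpaceTimeOn (Icc 0 D.T) D.wp :=
  Torus.IsSmoothSpaceTimeOn.sum fun x _ =>
    ((((smooth_atil h x).time_smul (contDiff_G h x).contDiffOn)).mul
      (Torus.isSmoothSpaceTimeOn_const (isSmooth_Ψ h x) _)).smul (Torus.isSmoothSpaceTimeOn_const (Torus.isSmooth_const _) _)

/-- `w^{(c)}` is jointly smooth on `[0, T]`. [folklore] -/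
theorem smooth_wc : Torus.IsSmoothSpaceTimeOn (Icc 0 D.T) D.wc :=
  Torus.IsSmoothSpaceTimeOn.sum fun x _ => (smooth_omegaApply h x (smooth_gradA h x)).time_smul (contDiff_G h x).contDiffOn

/-- `â_x²` is jointly smooth on `[0, T]`. [folklore] -/
theorem smooth_Bsc (x : Index d) : Torus.IsSmoothSpaceTimeOn (Icc 0 D.T) (D.Bsc x) :=
  show Torus.IsSmoothSpaceTimeOn (Icc 0 D.T) (fun t y => D.ahat x t y ^ 2) from (smooth_ahat h x).pow 2

/-- `B̂_x` is jointly smooth on `[0, T]`. [folklore] -/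
theorem smooth_Bten (x : Index d) : Torus.IsSmoothSpaceTimeOn (Icc 0 D.T) (D.Bten x) :=
  Torus.isSmoothSpaceTimeOn_of_columns fun j =>
    ((smooth_Bsc h x).mul (Torus.isSmoothSpaceTimeOn_const (Torus.isSmooth_const ((dir x j : ℤ) : ℝ)) _)).smul
      (Torus.isSmoothSpaceTimeOn_const (Torus.isSmooth_const _) _)

/-- `div B̂_x` is jointly smooth on `[0, T]`. [folklore] -/
theorem smooth_divBten (x : Index d) : Torus.IsSmoothSpaceTimeOn (Icc 0 D.T) (fun t => Torus.tensorDivergence (D.Bten x t)) :=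
  isSmoothSpaceTimeOn_tensorDivergence (smooth_Bten h x) (uniqueDiffOn h)

/-- `q̂_x` is jointly smooth on `[0, T]`. [folklore] -/
theorem smooth_qhat (x : Index d) : Torus.IsSmoothSpaceTimeOn (Icc 0 D.T) (D.qhat x) :=
  ((smooth_divBten h x).divergence (uniqueDiffOn h)).invLaplacian (convex_Icc 0 D.T)
    (by rw [interior_Icc]; exact nonempty_Ioo.2 h.hT)

/-- `Z_x` is jointly smooth on `[0, T]`. [folklore] -/
theorem smooth_Z (x : Index d) : Torus.IsSmoothSpaceTimeOn (Icc 0 D.T) (D.Z x) :=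
  (smooth_divBten h x).sub ((smooth_qhat h x).gradient (uniqueDiffOn h))

/-- `w^{(t)}` is jointly smooth on `[0, T]`. [folklore] -/
theorem smooth_wt : Torus.IsSmoothSpaceTimeOn (Icc 0 D.T) D.wt :=
  (Torus.IsSmoothSpaceTimeOn.sum fun x _ =>
    (smooth_Z h x).time_smul ((contDiff_H h x).mul (h.hθ.pow 2)).contDiffOn).neg

/-- **`w` is jointly smooth on `[0, T] × 𝕋^d`**. [cite: CheskidovLuo2022, §4.4] -/
theorem smooth_w : Torus.IsSmoothSpaceTimeOn (Icc 0 D.T) D.w := ((smooth_wp h).add (smooth_wc h)).add (smooth_wt h)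

end Smooth

/-! ## Vector calculus of the perturbation at a fixed time -/

section Algebra

variable {D}

omit [DecidableEq d] in
/-- `∫ div A = 0` over the torus for a smooth tensor field (private copy of
`Torus.integral_tensorDivergence_eq_zero` of `NSRPerturbation`, not imported here). [folklore] -/
private theorem integral_tensorDivergence_eq_zero' [DecidableEq d] {A : UnitAddTorus d → d → EuclideanSpace ℝ d}
    (hA : Torus.IsSmooth A) : ∫ y, Torus.tensorDivergence A y = 0 := by
  unfold Torus.tensorDivergence
  rw [integral_finsetSum _ fun j _ => ((hA.column j).partialDeriv j).integrable]
  exact Finset.sum_eq_zero fun j _ => Torus.integral_partialDeriv_eq_zero_holds (hA.column j) j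

/-- `div ∇φ = Δφ` for smooth scalar `φ` (private copy of `Torus.divergence_gradient_eq_laplacian`
of `DuchonRobertPressure`, not imported here). [folklore] -/
private theorem divergence_gradient_eq_laplacian' {φ : UnitAddTorus d → ℝ} (hφ : Torus.IsSmooth φ) (x : UnitAddTorus d) :
    Torus.divergence (Torus.gradient φ) x = Torus.laplacian φ x := by
  rw [Torus.divergence, Torus.laplacian_eq_sum_partialDeriv_partialDeriv hφ]
  refine Finset.sum_congr rfl fun i _ => ?_
  congr 1
  funext y
  exact Torus.gradient_apply (hφ.isContDiff (by simp)) y i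

/-- **`div div V = 0` for a smooth skew-symmetric tensor field** (`∑ᵢⱼ ∂ᵢ∂ⱼ Vᵢⱼ = 0` by
antisymmetry and the symmetry of second derivatives). [folklore] -/
theorem divergence_tensorDivergence_of_skew {V : UnitAddTorus d → d → EuclideanSpace ℝ d} (hV : Torus.IsSmooth V)
    (hskew : ∀ y i j, V y i j = -V y j i) (y : UnitAddTorus d) :
    Torus.divergence (Torus.tensorDivergence V) y = 0 := by
  have hc : ∀ i j, Torus.IsSmooth (fun z => V z j i) := fun i j => (hV.column j).apply i
  have h1 : ∀ {f : UnitAddTorus d → ℝ}, Torus.IsSmooth f → Torus.IsContDiff 1 f := fun hf => hf.isContDiff (by simp)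
  -- coordinates of `div V`
  have hcoord : ∀ i, (fun z => Torus.tensorDivergence V z i) = fun z => ∑ j, Torus.partialDeriv j (fun z => V z j i) z :=
    fun i => funext fun z => Torus.tensorDivergence_apply_eq hV z i
  set S : ℝ := ∑ i, ∑ j, Torus.partialDeriv i (Torus.partialDeriv j (fun z => V z j i)) y with hS
  have hdiv : Torus.divergence (Torus.tensorDivergence V) y = S := by
    unfold Torus.divergence
    refine Finset.sum_congr rfl fun i _ => ?_
    rw [hcoord i, Torus.partialDeriv_finset_sum _ fun j _ => h1 ((hc i j).partialDeriv j)]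
  -- antisymmetry: `S = -S`
  have hneg : ∀ i j, (fun z => V z j i) = fun z => (-1 : ℝ) * V z i j := by
    intro i j; funext z; rw [hskew z j i]; ring
  have hS' : S = -S := by
    calc S = ∑ i, ∑ j, Torus.partialDeriv i (Torus.partialDeriv j (fun z => (-1 : ℝ) * V z i j)) y := by
          rw [hS]; refine Finset.sum_congr rfl fun i _ => Finset.sum_congr rfl fun j _ => by rw [hneg i j]
      _ = ∑ i, ∑ j, -Torus.partialDeriv i (Torus.partialDeriv j (fun z => V z i j)) y := by
          refine Finset.sum_congr rfl fun i _ => Finset.sum_congr rfl fun j _ => ?_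
          have e1 : Torus.partialDeriv j (fun z => (-1 : ℝ) * V z i j) = fun z => (-1 : ℝ) * Torus.partialDeriv j (fun z => V z i j) z :=
            funext fun z => Torus.partialDeriv_const_mul_apply (h1 (hc j i)) (-1) j z
          rw [e1, Torus.partialDeriv_const_mul_apply (h1 ((hc j i).partialDeriv j))]
          ring
      _ = -∑ j, ∑ i, Torus.partialDeriv i (Torus.partialDeriv j (fun z => V z i j)) y := by
          rw [Finset.sum_comm]; simp [Finset.sum_neg_distrib]
      _ = -∑ j, ∑ i, Torus.partialDeriv j (Torus.partialDeriv i (fun z => V z i j)) y := by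
          congr 1
          exact Finset.sum_congr rfl fun j _ => Finset.sum_congr rfl fun i _ => Torus.partialDeriv_comm (hc j i) i j y
      _ = -S := by rw [hS]
  rw [hdiv]
  linarith

variable (h : D.Valid)
include h

/-- Slices of `ã_x` are smooth. [folklore] -/
theorem isSmooth_atil (x : Index d) {t : ℝ} (ht : t ∈ Icc 0 D.T) : Torus.IsSmooth (D.atil x t) :=
  (smooth_atil h x).isSmooth_slice ht

/-- `(∇ã_x)ⱼ = ∂ⱼã_x`. [folklore] -/
theorem gradA_apply (x : Index d) {t : ℝ} (ht : t ∈ Icc 0 D.T) (y : UnitAddTorus d) (j : d) :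
    D.gradA x t y j = Torus.partialDeriv j (D.atil x t) y :=
  Torus.gradient_apply ((isSmooth_atil h x ht).isContDiff (by simp)) y j

/-- **The skew potential** `V_x = ã_x Ω̃_x`, by columns: column `j` is
`ã_x (∂ⱼP_x k_x - (k_x)ⱼ ∇P_x)` (CL22 (4.18): `w^{(p)} + w^{(c)} = σ⁻¹ div ∑ a_k Ω_k(σ·)`, here per
direction and without the time factor). [cite: CheskidovLuo2022, §4.4 (4.18)] -/
def Vten (D : Datum d) (x : Index d) (t : ℝ) : UnitAddTorus d → d → EuclideanSpace ℝ d :=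
  fun y j => D.atil x t y • (Torus.partialDeriv j (D.P x) y • dirVec x - ((dir x j : ℤ) : ℝ) • Torus.gradient (D.P x) y)

/-- `V_x` is skew-symmetric. [folklore] -/
theorem Vten_skew (x : Index d) (t : ℝ) (y : UnitAddTorus d) (i j : d) : D.Vten x t y i j = -D.Vten x t y j i := by
  have hP : Torus.IsContDiff 1 (D.P x) := (isSmooth_P h x).isContDiff (by simp)
  simp only [Vten, PiLp.smul_apply, PiLp.sub_apply, smul_eq_mul, Torus.gradient_apply hP, dirVec]
  ring

/-- Slices of `V_x` are smooth. [folklore] -/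
theorem isSmooth_Vten (x : Index d) {t : ℝ} (ht : t ∈ Icc 0 D.T) : Torus.IsSmooth (D.Vten x t) := by
  have hP := isSmooth_P h x
  exact contDiff_pi.2 fun j => (isSmooth_atil h x ht).smul'
    (((hP.partialDeriv j).smul' (Torus.isSmooth_const _)).sub ((hP.gradient).smul _))

/-- **`div V_x = ã_x ψ_x(σ·) k_x + Ω̃_x[∇ã_x]`**: the principal part plus the corrector, per direction
(`ΔP_x = ψ_x(σ·)` and `(k_x·∇)∂ᵢP_x = 0`; CL22 (4.18)). [cite: CheskidovLuo2022, §4.4 (4.18)] -/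
theorem tensorDivergence_Vten (x : Index d) {t : ℝ} (ht : t ∈ Icc 0 D.T) (y : UnitAddTorus d) :
    Torus.tensorDivergence (D.Vten x t) y = (D.atil x t y * D.Ψ x y) • dirVec x + D.omegaApply x y (D.gradA x t y) := by
  have hP := isSmooth_P h x
  have ha := isSmooth_atil h x ht
  have h1 : ∀ {f : UnitAddTorus d → EuclideanSpace ℝ d}, Torus.IsSmooth f → Torus.IsContDiff 1 f :=
    fun hf => hf.isContDiff (by simp)
  have h1s : ∀ {f : UnitAddTorus d → ℝ}, Torus.IsSmooth f → Torus.IsContDiff 1 f := fun hf => hf.isContDiff (by simp)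
  -- the columns `W_j = ∂ⱼP k - k_j ∇P` and their derivatives
  set W : d → UnitAddTorus d → EuclideanSpace ℝ d :=
    fun j z => Torus.partialDeriv j (D.P x) z • dirVec x - ((dir x j : ℤ) : ℝ) • Torus.gradient (D.P x) z with hW
  have hWs : ∀ j, Torus.IsSmooth (W j) := fun j =>
    ((hP.partialDeriv j).smul' (Torus.isSmooth_const _)).sub ((hP.gradient).smul _)
  have hdW : ∀ j, Torus.partialDeriv j (W j) y = Torus.partialDeriv j (Torus.partialDeriv j (D.P x)) y • dirVec x -
      ((dir x j : ℤ) : ℝ) • Torus.partialDeriv j (Torus.gradient (D.P x)) y := by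
    intro j
    have e : W j = fun z => (fun z => Torus.partialDeriv j (D.P x) z • dirVec x) z +
        (fun z => (-((dir x j : ℤ) : ℝ)) • Torus.gradient (D.P x) z) z := by
      funext z; simp only [hW, neg_smul, sub_eq_add_neg]
    have hA : Torus.IsContDiff 1 (fun z => Torus.partialDeriv j (D.P x) z • dirVec x) :=
      h1 ((hP.partialDeriv j).smul' (Torus.isSmooth_const _))
    have hB : Torus.IsContDiff 1 (fun z => (-((dir x j : ℤ) : ℝ)) • Torus.gradient (D.P x) z) := h1 (hP.gradient.smul _)
    rw [e, Torus.partialDeriv_add_apply hA hB, Torus.partialDeriv_smul' (h1s (hP.partialDeriv j)) (Torus.isContDiff_const _),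
      Torus.partialDeriv_const_apply, smul_zero, add_zero,
      show (fun z => (-((dir x j : ℤ) : ℝ)) • Torus.gradient (D.P x) z) = (-((dir x j : ℤ) : ℝ)) • Torus.gradient (D.P x) from rfl,
      Torus.partialDeriv_const_smul (h1 hP.gradient)]
    simp [sub_eq_add_neg]
  -- `∑ⱼ kⱼ ∂ⱼ∇P = 0` and `∑ⱼ ∂ⱼ∂ⱼP = Ψ`
  have hkgrad : ∑ j, ((dir x j : ℤ) : ℝ) • Torus.partialDeriv j (Torus.gradient (D.P x)) y = 0 := by
    ext i
    rw [Torus.euclidean_sum_apply]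
    simp only [PiLp.smul_apply, smul_eq_mul, PiLp.zero_apply]
    have e : ∀ j, Torus.partialDeriv j (Torus.gradient (D.P x)) y i = Torus.partialDeriv j (Torus.partialDeriv i (D.P x)) y := by
      intro j
      rw [← Torus.partialDeriv_apply_coord (h1 hP.gradient) j y i]
      congr 1; funext z; exact Torus.gradient_apply (h1s hP) z i
    simp_rw [e]
    exact dirD_partialDeriv_phiR x h.hμ h.hσ i y
  have hlap : ∑ j, Torus.partialDeriv j (Torus.partialDeriv j (D.P x)) y = D.Ψ x y := by
    rw [← Torus.laplacian_eq_sum_partialDeriv_partialDeriv hP]; exact laplacian_phiR x h.hμ h.hσ y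
  -- expand the divergence
  have hcol : ∀ j, (fun z => D.Vten x t z j) = fun z => D.atil x t z • W j z := fun j => rfl
  unfold Torus.tensorDivergence
  simp_rw [hcol, Torus.partialDeriv_smul' (h1s ha) (h1 (hWs _)), hdW]
  rw [Finset.sum_add_distrib]
  -- first sum: `∑ⱼ ∂ⱼã • W_j = Ω̃[∇ã]`
  have hfirst : ∑ j, Torus.partialDeriv j (D.atil x t) y • W j y = D.omegaApply x y (D.gradA x t y) := by
    simp only [hW, omegaApply, gradA_apply h x ht, smul_sub, smul_smul, Finset.sum_sub_distrib, ← Finset.sum_smul]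
    congr 1
    all_goals first | rfl | (congr 1; exact Finset.sum_congr rfl fun j _ => mul_comm _ _)
  -- second sum: `ã • (ΔP k - ∑ kⱼ∂ⱼ∇P) = ã Ψ k`
  have hsecond : ∑ j, D.atil x t y • (Torus.partialDeriv j (Torus.partialDeriv j (D.P x)) y • dirVec x -
      ((dir x j : ℤ) : ℝ) • Torus.partialDeriv j (Torus.gradient (D.P x)) y) = (D.atil x t y * D.Ψ x y) • dirVec x := by
    rw [← Finset.smul_sum, Finset.sum_sub_distrib, hkgrad, sub_zero, ← Finset.sum_smul, hlap, smul_smul]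
  rw [hfirst, hsecond, add_comm]

/-- **`w^{(p)} + w^{(c)} = ∑_x G_x div V_x`** (CL22 (4.18)). [cite: CheskidovLuo2022, §4.4 (4.18)] -/
theorem wp_add_wc {t : ℝ} (ht : t ∈ Icc 0 D.T) (y : UnitAddTorus d) :
    D.wp t y + D.wc t y = ∑ x, D.G x t • Torus.tensorDivergence (D.Vten x t) y := by
  rw [wp, wc, ← Finset.sum_add_distrib]
  refine Finset.sum_congr rfl fun x _ => ?_
  rw [tensorDivergence_Vten h x ht y, smul_add, smul_smul, mul_assoc]

/-- `div (w^{(p)} + w^{(c)}) = 0`. [cite: CheskidovLuo2022, §4.4 (4.18)] -/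
theorem divergence_wp_add_wc {t : ℝ} (ht : t ∈ Icc 0 D.T) (y : UnitAddTorus d) :
    Torus.divergence (fun z => D.wp t z + D.wc t z) y = 0 := by
  have e : (fun z => D.wp t z + D.wc t z) = fun z => ∑ x, D.G x t • Torus.tensorDivergence (D.Vten x t) z :=
    funext fun z => wp_add_wc h ht z
  rw [e]
  have hterm : ∀ x, Torus.IsDivFree (fun z => D.G x t • Torus.tensorDivergence (D.Vten x t) z) := fun x =>
    Torus.isDivFree_const_smul ((isSmooth_Vten h x ht).tensorDivergence.isContDiff (by simp))
      (fun z => divergence_tensorDivergence_of_skew (isSmooth_Vten h x ht) (Vten_skew h x t) z) _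
  have hsm : ∀ x, Torus.IsSmooth (fun z => D.G x t • Torus.tensorDivergence (D.Vten x t) z) := fun x =>
    (isSmooth_Vten h x ht).tensorDivergence.smul _
  -- finite sums of divergence-free smooth fields
  have key : ∀ s : Finset (Index d), Torus.IsDivFree (fun z => ∑ x ∈ s, D.G x t • Torus.tensorDivergence (D.Vten x t) z) := by
    intro s
    induction s using Finset.induction_on with
    | empty => intro z; simp [Torus.divergence, Torus.partialDeriv_const_apply]
    | insert a s ha ih =>
      have e2 : (fun z => ∑ x ∈ insert a s, D.G x t • Torus.tensorDivergence (D.Vten x t) z) =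
          fun z => D.G a t • Torus.tensorDivergence (D.Vten a t) z + ∑ x ∈ s, D.G x t • Torus.tensorDivergence (D.Vten x t) z := by
        funext z; rw [Finset.sum_insert ha]
      rw [e2]
      exact Torus.IsDivFree.add ((hsm a).isContDiff (by simp))
        ((Torus.isSmooth_finset_sum s fun x _ => hsm x).isContDiff (by simp)) (hterm a) ih
  exact key Finset.univ y

/-- `∫ (w^{(p)} + w^{(c)}) = 0`. [folklore] -/
theorem integral_wp_add_wc {t : ℝ} (ht : t ∈ Icc 0 D.T) : ∫ y, (D.wp t y + D.wc t y) = 0 := by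
  calc ∫ y, (D.wp t y + D.wc t y) = ∫ y, ∑ x, D.G x t • Torus.tensorDivergence (D.Vten x t) y := by
        congr 1; funext y; exact wp_add_wc h ht y
    _ = 0 := by
        rw [integral_finsetSum _ fun x _ =>
          show Integrable (fun y => D.G x t • Torus.tensorDivergence (D.Vten x t) y) volume from
            ((isSmooth_Vten h x ht).tensorDivergence.integrable.smul (D.G x t))]
        refine Finset.sum_eq_zero fun x _ => ?_
        rw [integral_smul, integral_tensorDivergence_eq_zero' (isSmooth_Vten h x ht), smul_zero]

/-- Slices of `B̂_x` are smooth. [folklore] -/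
theorem isSmooth_Bten (x : Index d) {t : ℝ} (ht : t ∈ Icc 0 D.T) : Torus.IsSmooth (D.Bten x t) := (smooth_Bten h x).isSmooth_slice ht

/-- Slices of `q̂_x` are smooth. [folklore] -/
theorem isSmooth_qhat (x : Index d) {t : ℝ} (ht : t ∈ Icc 0 D.T) : Torus.IsSmooth (D.qhat x t) := (smooth_qhat h x).isSmooth_slice ht

/-- Slices of `Z_x` are smooth. [folklore] -/
theorem isSmooth_Z (x : Index d) {t : ℝ} (ht : t ∈ Icc 0 D.T) : Torus.IsSmooth (D.Z x t) := (smooth_Z h x).isSmooth_slice ht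

/-- **`div Z_x = 0`**: `div 𝒫 v = div v - ΔΔ⁻¹ div v = ∫ div v = 0`. [cite: CheskidovLuo2022, §4.4 (4.19)] -/
theorem divergence_Z (x : Index d) {t : ℝ} (ht : t ∈ Icc 0 D.T) (y : UnitAddTorus d) : Torus.divergence (D.Z x t) y = 0 := by
  haveI : Nonempty d := Fintype.card_pos_iff.1 (by have := h.hd; omega)
  have hB := isSmooth_Bten h x ht
  have hdB : Torus.IsSmooth (Torus.tensorDivergence (D.Bten x t)) := hB.tensorDivergence
  have hq := isSmooth_qhat h x ht
  have e : D.Z x t = fun z => Torus.tensorDivergence (D.Bten x t) z + ((-1 : ℝ) • Torus.gradient (D.qhat x t)) z := by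
    funext z; simp [Z, sub_eq_add_neg]
  rw [e, Torus.divergence_add_apply (hdB.isContDiff (by simp)) ((hq.gradient.smul _).isContDiff (by simp)),
    Torus.divergence_const_smul (hq.gradient.isContDiff (by simp)), divergence_gradient_eq_laplacian' hq,
    qhat, Torus.laplacian_invLaplacian hdB.divergence, Torus.integral_divergence_eq_zero_holds hdB]
  ring

/-- `∫ Z_x = 0`. [folklore] -/
theorem integral_Z (x : Index d) {t : ℝ} (ht : t ∈ Icc 0 D.T) : ∫ y, D.Z x t y = 0 := by
  have hB := isSmooth_Bten h x ht
  have hq := isSmooth_qhat h x ht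
  unfold Z
  rw [integral_sub hB.tensorDivergence.integrable hq.gradient.integrable, integral_tensorDivergence_eq_zero' hB,
    Torus.integral_gradient_eq_zero hq, sub_zero]

/-- `div w^{(t)} = 0`. [folklore] -/
theorem divergence_wt {t : ℝ} (ht : t ∈ Icc 0 D.T) (y : UnitAddTorus d) : Torus.divergence (D.wt t) y = 0 := by
  have hZ : ∀ x, Torus.IsSmooth (fun z => (D.H x t * D.θ t ^ 2) • D.Z x t z) := fun x => (isSmooth_Z h x ht).smul _
  have hterm : ∀ x, Torus.IsDivFree (fun z => (D.H x t * D.θ t ^ 2) • D.Z x t z) := fun x =>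
    Torus.isDivFree_const_smul ((isSmooth_Z h x ht).isContDiff (by simp)) (fun z => divergence_Z h x ht z) _
  have key : ∀ s : Finset (Index d), Torus.IsDivFree (fun z => ∑ x ∈ s, (D.H x t * D.θ t ^ 2) • D.Z x t z) := by
    intro s
    induction s using Finset.induction_on with
    | empty => intro z; simp [Torus.divergence, Torus.partialDeriv_const_apply]
    | insert a s ha ih =>
      have e2 : (fun z => ∑ x ∈ insert a s, (D.H x t * D.θ t ^ 2) • D.Z x t z) =
          fun z => (D.H a t * D.θ t ^ 2) • D.Z a t z + ∑ x ∈ s, (D.H x t * D.θ t ^ 2) • D.Z x t z := by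
        funext z; rw [Finset.sum_insert ha]
      rw [e2]
      exact Torus.IsDivFree.add ((hZ a).isContDiff (by simp))
        ((Torus.isSmooth_finset_sum s fun x _ => hZ x).isContDiff (by simp)) (hterm a) ih
  have e : D.wt t = (-1 : ℝ) • fun z => ∑ x, (D.H x t * D.θ t ^ 2) • D.Z x t z := by
    funext z
    show D.wt t z = (-1 : ℝ) • ∑ x, (D.H x t * D.θ t ^ 2) • D.Z x t z
    rw [neg_one_smul]; rfl
  rw [e, Torus.divergence_const_smul ((Torus.isSmooth_finset_sum _ fun x _ => hZ x).isContDiff (by simp)), key Finset.univ y,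
    mul_zero]

/-- `∫ w^{(t)} = 0`. [folklore] -/
theorem integral_wt {t : ℝ} (ht : t ∈ Icc 0 D.T) : ∫ y, D.wt t y = 0 := by
  unfold wt
  rw [integral_neg, integral_finsetSum _ fun x _ =>
    show Integrable (fun y => (D.H x t * D.θ t ^ 2) • D.Z x t y) volume from
      ((isSmooth_Z h x ht).integrable.smul (D.H x t * D.θ t ^ 2))]
  simp [integral_smul, integral_Z h _ ht]

/-- **`div w = 0` on `[0, T]`**. [cite: CheskidovLuo2022, §4.4 (4.18)–(4.19)] -/
theorem isDivFree_w {t : ℝ} (ht : t ∈ Icc 0 D.T) : Torus.IsDivFree (D.w t) := by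
  have e : D.w t = fun z => (fun z => D.wp t z + D.wc t z) z + D.wt t z := rfl
  rw [e]
  exact Torus.IsDivFree.add ((((smooth_wp h).add (smooth_wc h)).isSmooth_slice ht).isContDiff (by simp))
    (((smooth_wt h).isSmooth_slice ht).isContDiff (by simp)) (fun z => divergence_wp_add_wc h ht z) (fun z => divergence_wt h ht z)

/-- **`∫ w = 0` on `[0, T]`**. [folklore] -/
theorem hasZeroMean_w {t : ℝ} (ht : t ∈ Icc 0 D.T) : Torus.HasZeroMean (D.w t) := by
  unfold Torus.HasZeroMean
  have e : D.w t = fun z => (D.wp t z + D.wc t z) + D.wt t z := rfl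
  rw [e, integral_add ((((smooth_wp h).add (smooth_wc h)).isSmooth_slice ht).integrable) (((smooth_wt h).isSmooth_slice ht).integrable),
    integral_wp_add_wc h ht, integral_wt h ht, add_zero]

/-! ### Vanishing where the cut-off vanishes -/

omit h in
/-- `ã_x(t) = 0` where `θ(t) = 0`. [folklore] -/
theorem atil_eq_zero {t : ℝ} (hθ0 : D.θ t = 0) (x : Index d) : D.atil x t = fun _ => 0 := by
  funext y; simp [atil, hθ0]

omit h in
/-- `∇ã_x(t) = 0` where `θ(t) = 0`. [folklore] -/
theorem gradA_eq_zero {t : ℝ} (hθ0 : D.θ t = 0) (x : Index d) (y : UnitAddTorus d) : D.gradA x t y = 0 := by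
  rw [gradA, atil_eq_zero hθ0]; exact Torus.gradient_const 0 y

omit h in
/-- `Ω̃_x[0] = 0`. [folklore] -/
theorem omegaApply_zero (x : Index d) (y : UnitAddTorus d) : D.omegaApply x y 0 = 0 := by
  simp [omegaApply]

omit h in
/-- **`w(t) = 0` where `θ(t) = 0`** (CL22 Lemma 4.6: the perturbation is supported where the
cut-off is active). [cite: CheskidovLuo2022, §4.5 Lemma 4.6] -/
theorem w_eq_zero {t : ℝ} (hθ0 : D.θ t = 0) (y : UnitAddTorus d) : D.w t y = 0 := by
  have h1 : D.wp t y = 0 := by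
    simp only [wp, atil_eq_zero hθ0]; simp
  have h2 : D.wc t y = 0 := by
    simp only [wc, gradA_eq_zero hθ0, omegaApply_zero, smul_zero, Finset.sum_const_zero]
  have h3 : D.wt t y = 0 := by
    simp [wt, hθ0]
  rw [w, h1, h2, h3, add_zero, add_zero]

end Algebra

/-! ## Time derivatives on `[0, T]` -/

section Time

variable {D}

/-- `Ω̃_x(y)` as a continuous linear map. [folklore] -/
def omegaCLM (D : Datum d) (x : Index d) (y : UnitAddTorus d) : EuclideanSpace ℝ d →L[ℝ] EuclideanSpace ℝ d :=
  (∑ j, Torus.partialDeriv j (D.P x) y • (EuclideanSpace.proj j : EuclideanSpace ℝ d →L[ℝ] ℝ)).smulRight (dirVec x) -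
    (∑ j, ((dir x j : ℤ) : ℝ) • (EuclideanSpace.proj j : EuclideanSpace ℝ d →L[ℝ] ℝ)).smulRight (Torus.gradient (D.P x) y)

/-- `Ω̃_x(y) v` agrees with the continuous linear map. [folklore] -/
theorem omegaCLM_apply (x : Index d) (y : UnitAddTorus d) (v : EuclideanSpace ℝ d) :
    D.omegaCLM x y v = D.omegaApply x y v := by
  simp [omegaCLM, omegaApply, ContinuousLinearMap.smulRight_apply, smul_eq_mul]

variable (h : D.Valid)
include h

/-- **`∂ₜw^{(p)}`** on `[0, T]`:
`∂ₜw^{(p)} = ∑_x ((G_x' ã_x + G_x ∂ₜã_x) ψ_x(σ·)) k_x`. [cite: CheskidovLuo2022, §4.5 Lemma 4.5] -/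
theorem timeDerivWithin_wp {t : ℝ} (ht : t ∈ Icc 0 D.T) (y : UnitAddTorus d) :
    Torus.timeDerivWithin (Icc 0 D.T) D.wp t y =
      ∑ x, ((D.dG x t * D.atil x t y + D.G x t * Torus.timeDerivWithin (Icc 0 D.T) (D.atil x) t y) * D.Ψ x y) • dirVec x := by
  have key : HasDerivWithinAt (fun s => D.wp s y)
      (∑ x, ((D.dG x t * D.atil x t y + D.G x t * Torus.timeDerivWithin (Icc 0 D.T) (D.atil x) t y) * D.Ψ x y) • dirVec x)
      (Icc 0 D.T) t := by
    unfold wp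
    refine HasDerivWithinAt.fun_sum fun x _ => ?_
    have hG := (hasDerivAt_G h x t).hasDerivWithinAt (s := Icc 0 D.T)
    have hA := (smooth_atil h x).hasDerivWithinAt_slice ht y
    have h3 := ((hG.mul hA).mul_const (D.Ψ x y)).smul_const (dirVec x)
    refine h3.congr_deriv ?_
    ring_nf
  exact key.derivWithin (uniqueDiffOn h t ht)

/-- **`∂ₜw^{(c)}`** on `[0, T]`: `∂ₜw^{(c)} = ∑_x (G_x Ω̃_x[∂ₜ∇ã_x] + G_x' Ω̃_x[∇ã_x])`. [cite: CheskidovLuo2022, §4.5 Lemma 4.5] -/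
theorem timeDerivWithin_wc {t : ℝ} (ht : t ∈ Icc 0 D.T) (y : UnitAddTorus d) :
    Torus.timeDerivWithin (Icc 0 D.T) D.wc t y =
      ∑ x, (D.G x t • D.omegaApply x y (Torus.timeDerivWithin (Icc 0 D.T) (D.gradA x) t y) +
        D.dG x t • D.omegaApply x y (D.gradA x t y)) := by
  have key : HasDerivWithinAt (fun s => D.wc s y)
      (∑ x, (D.G x t • D.omegaApply x y (Torus.timeDerivWithin (Icc 0 D.T) (D.gradA x) t y) +
        D.dG x t • D.omegaApply x y (D.gradA x t y))) (Icc 0 D.T) t := by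
    unfold wc
    refine HasDerivWithinAt.fun_sum fun x _ => ?_
    have hG := (hasDerivAt_G h x t).hasDerivWithinAt (s := Icc 0 D.T)
    have hE := (smooth_gradA h x).hasDerivWithinAt_slice ht y
    have hΩ : HasDerivWithinAt (fun s => D.omegaApply x y (D.gradA x s y))
        (D.omegaApply x y (Torus.timeDerivWithin (Icc 0 D.T) (D.gradA x) t y)) (Icc 0 D.T) t := by
      have h1 := (D.omegaCLM x y).hasFDerivAt.comp_hasDerivWithinAt t hE
      rw [omegaCLM_apply] at h1
      exact h1.congr (fun s _ => by simp only [Function.comp_apply, omegaCLM_apply])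
        (by simp only [Function.comp_apply, omegaCLM_apply])
    exact hG.smul hΩ
  exact key.derivWithin (uniqueDiffOn h t ht)

/-- **`∂ₜw^{(t)}`** on `[0, T]`:
`∂ₜw^{(t)} = -∑_x (H_xθ² ∂ₜZ_x + ((G_x² - 1)θ² + H_x (θ²)') Z_x)` (`H_x' = G_x² - 1`, CL22 (4.11)). [cite: CheskidovLuo2022, §4.5 Lemma 4.5] -/
theorem timeDerivWithin_wt {t : ℝ} (ht : t ∈ Icc 0 D.T) (y : UnitAddTorus d) :
    Torus.timeDerivWithin (Icc 0 D.T) D.wt t y =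
      -∑ x, ((D.H x t * D.θ t ^ 2) • Torus.timeDerivWithin (Icc 0 D.T) (D.Z x) t y +
        ((D.G x t ^ 2 - 1) * D.θ t ^ 2 + D.H x t * deriv (fun s => D.θ s ^ 2) t) • D.Z x t y) := by
  have hθ2 : HasDerivAt (fun s => D.θ s ^ 2) (deriv (fun s => D.θ s ^ 2) t) t :=
    ((h.hθ.pow 2).differentiable (by simp)).differentiableAt.hasDerivAt
  have key : HasDerivWithinAt (fun s => D.wt s y)
      (-∑ x, ((D.H x t * D.θ t ^ 2) • Torus.timeDerivWithin (Icc 0 D.T) (D.Z x) t y +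
        ((D.G x t ^ 2 - 1) * D.θ t ^ 2 + D.H x t * deriv (fun s => D.θ s ^ 2) t) • D.Z x t y)) (Icc 0 D.T) t := by
    unfold wt
    refine HasDerivWithinAt.neg (HasDerivWithinAt.fun_sum fun x _ => ?_)
    have hc : HasDerivWithinAt (fun s => D.H x s * D.θ s ^ 2)
        ((D.G x t ^ 2 - 1) * D.θ t ^ 2 + D.H x t * deriv (fun s => D.θ s ^ 2) t) (Icc 0 D.T) t :=
      ((hasDerivAt_H h x t).mul hθ2).hasDerivWithinAt
    have hZ := (smooth_Z h x).hasDerivWithinAt_slice ht y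
    exact hc.smul hZ
  exact key.derivWithin (uniqueDiffOn h t ht)

/-- **`∂ₜw = ∂ₜw^{(p)} + ∂ₜw^{(c)} + ∂ₜw^{(t)}`** on `[0, T]`. [folklore] -/
theorem timeDerivWithin_w {t : ℝ} (ht : t ∈ Icc 0 D.T) (y : UnitAddTorus d) :
    Torus.timeDerivWithin (Icc 0 D.T) D.w t y =
      Torus.timeDerivWithin (Icc 0 D.T) D.wp t y + Torus.timeDerivWithin (Icc 0 D.T) D.wc t y +
        Torus.timeDerivWithin (Icc 0 D.T) D.wt t y := by
  have h1 := (smooth_wp h).hasDerivWithinAt_slice ht y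
  have h2 := (smooth_wc h).hasDerivWithinAt_slice ht y
  have h3 := (smooth_wt h).hasDerivWithinAt_slice ht y
  exact ((h1.add h2).add h3).derivWithin (uniqueDiffOn h t ht)

/-! ### Vanishing of the time derivatives of the amplitudes where `θ = θ' = 0` -/

/-- `∂ₜã_x(t) = 0` where `θ(t) = θ'(t) = 0`. [folklore] -/
theorem timeDerivWithin_atil_eq_zero {t : ℝ} (ht : t ∈ Icc 0 D.T) (hθ0 : D.θ t = 0) (hθ1 : deriv D.θ t = 0)
    (x : Index d) (y : UnitAddTorus d) : Torus.timeDerivWithin (Icc 0 D.T) (D.atil x) t y = 0 := by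
  have hθ : HasDerivAt D.θ (deriv D.θ t) t := (h.hθ.differentiable (by simp)).differentiableAt.hasDerivAt
  have hA := (smooth_ahat h x).hasDerivWithinAt_slice ht y
  have key : HasDerivWithinAt (fun s => D.atil x s y) (deriv D.θ t * D.ahat x t y +
      D.θ t * Torus.timeDerivWithin (Icc 0 D.T) (D.ahat x) t y) (Icc 0 D.T) t := hθ.hasDerivWithinAt.mul hA
  rw [hθ0, hθ1, zero_mul, zero_mul, add_zero] at key
  exact key.derivWithin (uniqueDiffOn h t ht)

/-- `∂ₜ∇ã_x(t) = 0` where `θ(t) = θ'(t) = 0` (`∇ã_x = θ ∇â_x` on `[0, T]`). [folklore] -/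
theorem timeDerivWithin_gradA_eq_zero {t : ℝ} (ht : t ∈ Icc 0 D.T) (hθ0 : D.θ t = 0) (hθ1 : deriv D.θ t = 0)
    (x : Index d) (y : UnitAddTorus d) : Torus.timeDerivWithin (Icc 0 D.T) (D.gradA x) t y = 0 := by
  have hθ : HasDerivAt D.θ (deriv D.θ t) t := (h.hθ.differentiable (by simp)).differentiableAt.hasDerivAt
  have hA := ((smooth_ahat h x).gradient (uniqueDiffOn h)).hasDerivWithinAt_slice ht y
  have heq : ∀ s ∈ Icc 0 D.T, D.θ s • Torus.gradient (D.ahat x s) y = D.gradA x s y := by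
    intro s hs
    show D.θ s • Torus.gradient (D.ahat x s) y = Torus.gradient (fun z => D.θ s * D.ahat x s z) y
    exact (Torus.gradient_const_mul_apply (((smooth_ahat h x).isSmooth_slice hs).isContDiff (by simp)) (D.θ s) y).symm
  have key : HasDerivWithinAt (fun s => D.θ s • Torus.gradient (D.ahat x s) y)
      (D.θ t • Torus.timeDerivWithin (Icc 0 D.T) (fun s => Torus.gradient (D.ahat x s)) t y +
        deriv D.θ t • Torus.gradient (D.ahat x t) y) (Icc 0 D.T) t := hθ.hasDerivWithinAt.smul hA
  rw [hθ0, hθ1, zero_smul, zero_smul, add_zero] at key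
  exact (key.congr (fun s hs => (heq s hs).symm) (heq t ht).symm).derivWithin (uniqueDiffOn h t ht)

end Time

end Datum

end CL22

end Literature.Analysis.FluidPDE
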